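import Summits.SmoothPoincare4.SmoothPoincare4.Theorems.SymplecticOrigamiFoldedSphereFoldExistenceImmersionR5
import Summits.SmoothPoincare4.SmoothPoincare4.Theorems.SymplecticOrigamiFoldedSphereFoldExistenceImmersionR5StableFraming
import Literature.Topology.FourManifolds.ThetaFourKervaireMilnorProofs

/-!
# The fold-map fact implies Kervaire–Milnor 3.1 in dimension 4

Route `SmoothPoincare4/SymplecticOrigami`, support item `FoldedSphereFoldExistence`
(stmt-SmoothPoincare4-14076), closed modulo the named fact
`X = Literature.Topology.FourManifolds.eliashberg_foldMap_homotopySphere_four`. This file records,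
kernel-checked, where `X` sits in the tree's debt order:

* `hasMFDerivAt_prodModel_iff`, `mfderiv_prodModel_eq` — bookkeeping: derivatives into `ℝ⁴ × ℝ`
  for the product model `(𝓡 4).prod 𝓘(ℝ, ℝ)` and for `𝓘(ℝ, ℝ⁴ × ℝ)` agree;
* `isStablyParallelizable_of_immersion` / `…_prodReal` — an oriented 4-manifold immersing in a
  5-dimensional real normed space (resp. in `ℝ⁴ × ℝ` with the product model) is stably
  parallelisable (`exists_stableFrame_of_immersion`, part `…StableFraming`);
* `isStablyParallelizable_of_eliashbergFoldMap` — **`X → ∀ S : HomotopySphere 4,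
  IsStablyParallelizable (𝓡 4) S.carrier`**, verbatim the open hypothesis `h31` of
  `Literature.Barriers.SmoothPoincare4.stableBarrierFour_of_kervaireMilnorFrontier`
  (Kervaire–Milnor 1963, Thm. 3.1 for `n = 4`; in print only via the signature theorem,
  `HomotopySphere.isStablyParallelizable_four_of_sig`). Chain: fold map along a chart sphere
  (`X`) ⟹ immersion `S ↬ ℝ⁴ × ℝ` (Gromov PDR 2.1.3 (C″), `exists_immersion_prodReal_of_foldMap`)
  ⟹ stable framing (orientation of `S` + generalized cross product).

* `isHCobordant_sphere_of_homotopySphere_four_of_eliashbergFoldMap_of_frontier` — the same fed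
  into the tree's `Θ₄ = 0` frontier theorem (type-level check that the conclusion is `h31`).

So a discharge of `X` is at least a discharge of KM 3.1 (n = 4), independently of the
`h`-principle half (Gromov (D)) of its printed proof.
-/

noncomputable section

-- the prescribed namespace `Summit.<P>.<Sub>.…` duplicates `SmoothPoincare4` (P = Sub)
set_option linter.dupNamespace false

open scoped Manifold ContDiff Topology
open Set Function Bundle Module
open Literature.Topology.FourManifolds

namespace Summit.SmoothPoincare4.SmoothPoincare4.Theorems.FoldedSphereFoldExistence

variable {N : Type*} [TopologicalSpace N] [ChartedSpace (EuclideanSpace ℝ (Fin 4)) N]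

/-! ### Derivatives into `ℝ⁴ × ℝ`: product model versus `𝓘(ℝ, ℝ⁴ × ℝ)` -/

/-- The two ways of reading `ℝ⁴ × ℝ` as a manifold (product of the model spaces, or the model
space `ℝ⁴ × ℝ` itself) have the same extended charts (identities), so `HasMFDerivAt` agrees.
[folklore] -/
theorem hasMFDerivAt_prodModel_iff {f : N → (EuclideanSpace ℝ (Fin 4)) × ℝ} {x : N}
    {f' : (EuclideanSpace ℝ (Fin 4)) →L[ℝ] (EuclideanSpace ℝ (Fin 4)) × ℝ} :
    HasMFDerivAt (𝓡 4) ((𝓡 4).prod 𝓘(ℝ, ℝ)) f x f' ↔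
      HasMFDerivAt (𝓡 4) 𝓘(ℝ, (EuclideanSpace ℝ (Fin 4)) × ℝ) f x f' := by
  have hw : (writtenInExtChartAt (𝓡 4) ((𝓡 4).prod 𝓘(ℝ, ℝ)) x f :
      EuclideanSpace ℝ (Fin 4) → (EuclideanSpace ℝ (Fin 4)) × ℝ) =
        writtenInExtChartAt (𝓡 4) 𝓘(ℝ, (EuclideanSpace ℝ (Fin 4)) × ℝ) x f := by
    funext y
    simp only [writtenInExtChartAt, extChartAt_prod, extChartAt_model_space_eq_id,
      Function.comp_apply, PartialEquiv.prod_coe, PartialEquiv.refl_coe, id]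
  simp only [HasMFDerivAt, hw]
  exact Iff.rfl

/-- The `mfderiv` into `ℝ⁴ × ℝ` is the same for the two models, at points of
differentiability. [folklore] -/
theorem mfderiv_prodModel_eq {f : N → (EuclideanSpace ℝ (Fin 4)) × ℝ} {x : N}
    (h : MDifferentiableAt (𝓡 4) ((𝓡 4).prod 𝓘(ℝ, ℝ)) f x) :
    mfderiv (𝓡 4) 𝓘(ℝ, (EuclideanSpace ℝ (Fin 4)) × ℝ) f x =
      mfderiv (𝓡 4) ((𝓡 4).prod 𝓘(ℝ, ℝ)) f x :=
  (hasMFDerivAt_prodModel_iff.1 h.hasMFDerivAt).mfderiv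

/-! ### Stable parallelisability; the fold-map fact implies KM 3.1 (n = 4) -/

/-- **An oriented `C¹` 4-manifold immersing in a 5-dimensional real normed space is stably
parallelisable** (`Literature.Topology.FourManifolds.IsStablyParallelizable`: `TM ⊕ ℝ` admits a
continuous global frame), by `exists_stableFrame_of_immersion`. [cite: Hirsch1976, Ch. 4 §2] -/
theorem isStablyParallelizable_of_immersion [IsManifold (𝓡 4) ∞ N]
    {V : Type*} [NormedAddCommGroup V] [NormedSpace ℝ V] [FiniteDimensional ℝ V]
    (hV : finrank ℝ V = 5) (o : SmoothOrientation (𝓡 4) N) {F : N → V}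
    (hF : ContMDiff (𝓡 4) 𝓘(ℝ, V) 1 F)
    (hinj : ∀ x, Injective (mfderiv (𝓡 4) 𝓘(ℝ, V) F x)) :
    IsStablyParallelizable (𝓡 4) N := by
  obtain ⟨s, hs1, hs2, hli⟩ :=
    exists_stableFrame_of_immersion o (Module.finBasisOfFinrankEq ℝ V hV) hF hinj
  have h5 : finrank ℝ (EuclideanSpace ℝ (Fin 4)) + 1 = 5 := by simp
  refine ⟨fun i => s (Fin.cast h5 i), fun i => hs1 _, fun i => hs2 _, fun p => ?_⟩
  exact (hli p).comp (Fin.cast h5) (Fin.cast_injective h5)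

/-- **From the product model.** The same for a `C^∞` map `F : N → ℝ⁴ × ℝ` read in the product
model `(𝓡 4).prod 𝓘(ℝ, ℝ)` (the form produced by `exists_immersion_prodReal_of_foldMap`).
[cite: Hirsch1976, Ch. 4 §2] -/
theorem isStablyParallelizable_of_immersion_prodReal [IsManifold (𝓡 4) ∞ N]
    (o : SmoothOrientation (𝓡 4) N) {F : N → (EuclideanSpace ℝ (Fin 4)) × ℝ}
    (hF : ContMDiff (𝓡 4) ((𝓡 4).prod 𝓘(ℝ, ℝ)) ∞ F)
    (hinj : ∀ x, Injective (mfderiv (𝓡 4) ((𝓡 4).prod 𝓘(ℝ, ℝ)) F x)) :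
    IsStablyParallelizable (𝓡 4) N := by
  have hF' : ContMDiff (𝓡 4) 𝓘(ℝ, (EuclideanSpace ℝ (Fin 4)) × ℝ) 1 F := by
    have h := (hF.fst.prodMk_space hF.snd).of_le (show (1 : WithTop ℕ∞) ≤ ∞ by simp)
    simpa only [Prod.mk.eta] using h
  have hV : finrank ℝ ((EuclideanSpace ℝ (Fin 4)) × ℝ) = 5 := by
    rw [finrank_prod]; simp
  refine isStablyParallelizable_of_immersion hV o hF' fun x => ?_
  rw [mfderiv_prodModel_eq (hF.mdifferentiableAt (by simp))]
  exact hinj x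

/-- **`eliashberg_foldMap_homotopySphere_four` ⟹ Kervaire–Milnor 3.1 in dimension 4.** Granted
the named fact (Eliashberg's folding theorem, instance: every smooth homotopy 4-sphere admits a
fold map to `ℝ⁴` along a chart 3-sphere), every `S : HomotopySphere 4` is stably parallelisable:
the fold map lifts to an immersion `S ↬ ℝ⁴ × ℝ` (Gromov, PDR §2.1.3 (C″);
`exists_immersion_prodReal_homotopySphere_of_eliashbergFoldMap`), and an oriented 4-manifold
immersing in codimension one is stably parallelisable (`isStablyParallelizable_of_immersion_prodReal`,
with the orientation carried by `S`). The conclusion is VERBATIM the open hypothesis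
`h31 : ∀ S : HomotopySphere 4, IsStablyParallelizable (𝓡 4) S.carrier` of
`Literature.Barriers.SmoothPoincare4.stableBarrierFour_of_kervaireMilnorFrontier` (Kervaire–Milnor
1963, Thm. 3.1 for `n = 4`, in print via the signature theorem;
`Literature.Topology.FourManifolds.HomotopySphere.isStablyParallelizable_four_of_sig`): the
fold-map fact sits above that leaf in the debt order.
[cite: Gromov1986, §2.1.3 (C″) p. 58 and (D) p. 59] [cite: KervaireMilnorAnnals1963, Thm. 3.1] -/
theorem isStablyParallelizable_of_eliashbergFoldMap
    (h : Literature.Topology.FourManifolds.eliashberg_foldMap_homotopySphere_four)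
    (S : Literature.Topology.FourManifolds.HomotopySphere 4) :
    IsStablyParallelizable (𝓡 4) S.carrier := by
  obtain ⟨F, hF, hinj⟩ := exists_immersion_prodReal_homotopySphere_of_eliashbergFoldMap h S
  exact isStablyParallelizable_of_immersion_prodReal S.orientation hF hinj

/-- **The fold-map fact plugged into the tree's `Θ₄ = 0` frontier** (type-level certificate that
the conclusion above is VERBATIM the hypothesis `h31` of
`Literature.Topology.FourManifolds.isHCobordant_sphere_of_homotopySphere_four_of_frontier₄`):
granted the named fact and the three other remaining Kervaire–Milnor leaves (Lemma 4.2 `⇒`,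
`Π₄ = 0`, Thm. 5.1 at `n = 4`), every homotopy 4-sphere is `h`-cobordant to `S⁴`.
[cite: KervaireMilnorAnnals1963, table p. 504 (Θ₄ = 0) via Lemma 2.3, Thm. 3.1 (n = 4), §4 (Lemma 4.2, table p. 512) and Thm. 5.1] -/
theorem isHCobordant_sphere_of_homotopySphere_four_of_eliashbergFoldMap_of_frontier
    (hX : Literature.Topology.FourManifolds.eliashberg_foldMap_homotopySphere_four)
    (hb : boundsParallelizable_of_collapseNullHomotopic) (hPi : piStable_four_trivial)
    (h51 : HomotopySphere.boundsContractible_of_nullCobordism_isStablyParallelizable_four) :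
    isHCobordant_sphere_of_homotopySphere_four :=
  isHCobordant_sphere_of_homotopySphere_four_of_frontier₄
    (isStablyParallelizable_of_eliashbergFoldMap hX) hb hPi h51

end Summit.SmoothPoincare4.SmoothPoincare4.Theorems.FoldedSphereFoldExistence

end
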